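import Literature.Probability.LatticeModels.GibbsRelativeDensitySMT
import HarnessLib

/-!
# Two-block spectral gap for a box split into two overlapping halves, from `SMT` on moderate boxes
# ([Mar99] Theorem 4.5, proof: (3.33) via Proposition 2.12, then Proposition 3.5), PROVED

Topic `Literature/Probability/LatticeModels`; cell `ym-ir`, seat lit-3 (census rows B2/B4).  Theorems only
(D-0026).  The geometric instance of `Glauber.abs_spec_real_sub_union_le_of_local_SMT` needed in the proof of
[Mar99] Theorem 4.5 (p0188 L39 – p0189 L14): a box `Q = Π_i [a_i, b_i)` is covered by the two overlapping
boxes `Top = {y ∈ Q : y_j ≥ s}` and `Bot = {y ∈ Q : y_j < t}` (`s < t`, overlap width `t − s ≥ ρ + r`); if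
`SMT(·, l, m)` holds for all boxes with sides between `ρ + 1 − r` and `2ρ + 1` (for `d = 2`, `ρ ≥ 2r`: fat
rectangles of size `≤ 2ρ+1`), then the marginal of `μ_Top^τ` on `𝓕_{∂_r^+Bot}` is within the factor `1 ± ε` of
that of `μ_Q^τ` (`Glauber.boxSplit_density_bound`; `ε` explicit, super-polynomially small in `ρ` at fixed box
size growth), and by the PROVED Proposition 3.5 the block dynamics `{Top, Bot}` in `Q` has gap `≥ 1 − √ε`
(`Glauber.boxSplit_blockPoincare`).  The `SMT` hypothesis is used only on `ρ`-boxes INSIDE the overlap strip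
(sub-volume trick of `GibbsRelativeDensitySMT`), never on the thin strip itself.  SIBLING-SETTING result
(`±1` spins, range `r`); the Yang–Mills gap is not touched.  [cite: Martinelli1999, Theorem 4.5, proof, p0189 L3–14]
-/

open MeasureTheory ProbabilityTheory Finset Filter

noncomputable section

namespace Literature.Probability.LatticeModels

namespace Glauber

variable {d : ℕ}

/-! ### Boxes `Π_i [a_i, b_i)` and their splits along a coordinate -/

/-- Membership in a box `Π_i [a_i, b_i)` (the rectangles `R(l₁,l₂)+x` of [Mar99] §4.2 for `d = 2`).
[cite: Martinelli1999, §4.2 p0187 L14–16] -/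
theorem mem_IcoBox {a b : Site d} {y : Site d} :
    y ∈ (Fintype.piFinset fun i => Finset.Ico ((a) i) ((b) i)) ↔ ∀ i, a i ≤ y i ∧ y i < b i := by
  simp [Fintype.mem_piFinset, Finset.mem_Ico]

/-- Coordinates are `1`-Lipschitz for the sup-distance. [folklore] -/
private theorem abs_sub_le_supDist (x y : Site d) (i : Fin d) : |x i - y i| ≤ (supDist x y : ℤ) := by
  rw [Int.abs_eq_natAbs]
  exact_mod_cast natAbs_sub_le_supDist x y i

/-- A lower bound on one coordinate difference bounds the sup-distance below. [folklore] -/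
private theorem le_supDist_of_le_abs_sub {x y : Site d} {i : Fin d} {n : ℕ} (h : (n : ℤ) ≤ |x i - y i|) :
    n ≤ supDist x y := by
  have := abs_sub_le_supDist x y i
  exact_mod_cast h.trans this

/-- Coordinatewise bounds give a sup-distance bound. [folklore] -/
private theorem supDist_le_of_abs_sub_le {x y : Site d} {n : ℕ} (h : ∀ i, |x i - y i| ≤ n) : supDist x y ≤ n := by
  rw [supDist_le_iff]
  intro i
  have h1 := h i
  have h2 : ((x i - y i).natAbs : ℤ) = |x i - y i| := Int.natCast_natAbs _
  omega

/-- Triangle inequality for the sup-distance. [folklore] -/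
private theorem supDist_triangle'' (x y z : Site d) : supDist x z ≤ supDist x y + supDist y z := by
  rw [supDist_le_iff]
  intro i
  have e1 := natAbs_sub_le_supDist x y i
  have e2 := natAbs_sub_le_supDist y z i
  have : x i - z i = (x i - y i) + (y i - z i) := by ring
  rw [this]
  exact (Int.natAbs_add_le _ _).trans (Nat.add_le_add e1 e2)

section Split

variable (a b : Site d) (j : Fin d) (s t : ℤ)

/-- The upper part `R^{top} = {y_j ≥ s}` of the box is a sub-box ([Mar99] p0189 L1).
[cite: Martinelli1999, Theorem 4.5, proof, p0189 L1] -/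
theorem IcoBox_top_subset (hs : a j ≤ s) : (Fintype.piFinset fun i => Finset.Ico ((Function.update a j s) i) ((b) i)) ⊆ (Fintype.piFinset fun i => Finset.Ico ((a) i) ((b) i)) := by
  intro y hy
  rw [mem_IcoBox] at hy ⊢
  intro i
  obtain ⟨h1, h2⟩ := hy i
  by_cases hij : i = j
  · subst hij; rw [Function.update_self] at h1; exact ⟨hs.trans h1, h2⟩
  · rw [Function.update_of_ne hij] at h1; exact ⟨h1, h2⟩

/-- The lower part `R^{bot} = {y_j < t}` of the box is a sub-box ([Mar99] p0189 L1).
[cite: Martinelli1999, Theorem 4.5, proof, p0189 L1] -/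
theorem IcoBox_bot_subset (ht : t ≤ b j) : (Fintype.piFinset fun i => Finset.Ico ((a) i) ((Function.update b j t) i)) ⊆ (Fintype.piFinset fun i => Finset.Ico ((a) i) ((b) i)) := by
  intro y hy
  rw [mem_IcoBox] at hy ⊢
  intro i
  obtain ⟨h1, h2⟩ := hy i
  by_cases hij : i = j
  · subst hij; rw [Function.update_self] at h2; exact ⟨h1, h2.trans_le ht⟩
  · rw [Function.update_of_ne hij] at h2; exact ⟨h1, h2⟩

/-- The two parts cover the box when `s ≤ t` ([Mar99] p0188 L39: «we cover R with the following two
rectangles»). [cite: Martinelli1999, Theorem 4.5, proof, p0188 L39 – p0189 L1] -/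
theorem IcoBox_top_union_bot (hs : a j ≤ s) (hst : s ≤ t) (ht : t ≤ b j) :
    (Fintype.piFinset fun i => Finset.Ico ((Function.update a j s) i) ((b) i)) ∪ (Fintype.piFinset fun i => Finset.Ico ((a) i) ((Function.update b j t) i)) = (Fintype.piFinset fun i => Finset.Ico ((a) i) ((b) i)) := by
  refine Finset.Subset.antisymm
    (Finset.union_subset (IcoBox_top_subset a b j s hs) (IcoBox_bot_subset a b j t ht)) fun y hy => ?_
  rw [Finset.mem_union, mem_IcoBox, mem_IcoBox]
  rw [mem_IcoBox] at hy
  by_cases hyj : y j < t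
  · right; intro i
    by_cases hij : i = j
    · subst hij; rw [Function.update_self]; exact ⟨(hy i).1, hyj⟩
    · rw [Function.update_of_ne hij]; exact hy i
  · left; intro i
    by_cases hij : i = j
    · subst hij; rw [Function.update_self]; exact ⟨hst.trans (not_lt.1 hyj), (hy i).2⟩
    · rw [Function.update_of_ne hij]; exact hy i

/-- The overlap of the two parts is the strip `R^{top} ∩ R^{bot} = {s ≤ y_j < t}` ([Mar99] p0189 L15).
[cite: Martinelli1999, Theorem 4.5, proof, p0189 L15] -/
theorem IcoBox_top_inter_bot (hs : a j ≤ s) (ht : t ≤ b j) :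
    (Fintype.piFinset fun i => Finset.Ico ((Function.update a j s) i) ((b) i)) ∩ (Fintype.piFinset fun i => Finset.Ico ((a) i) ((Function.update b j t) i)) =
      (Fintype.piFinset fun i => Finset.Ico ((Function.update a j s) i) ((Function.update b j t) i)) := by
  ext y
  rw [Finset.mem_inter, mem_IcoBox, mem_IcoBox, mem_IcoBox]
  constructor
  · rintro ⟨h1, h2⟩ i
    exact ⟨(h1 i).1, (h2 i).2⟩
  · intro h
    have key : ∀ i, a i ≤ y i ∧ y i < b i := by
      intro i
      obtain ⟨h1, h2⟩ := h i
      by_cases hij : i = j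
      · subst hij
        rw [Function.update_self] at h1 h2
        exact ⟨hs.trans h1, h2.trans_le ht⟩
      · rw [Function.update_of_ne hij] at h1 h2
        exact ⟨h1, h2⟩
    exact ⟨fun i => ⟨(h i).1, (key i).2⟩, fun i => ⟨(key i).1, (h i).2⟩⟩

/-- A point of the box outside the upper part has `y_j < s`. [cite: Martinelli1999, Theorem 4.5, proof, p0189 L1] -/
theorem lt_of_not_mem_top {y : Site d} (hy : y ∈ (Fintype.piFinset fun i => Finset.Ico ((a) i) ((b) i))) (hyT : y ∉ (Fintype.piFinset fun i => Finset.Ico ((Function.update a j s) i) ((b) i))) : y j < s := by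
  rw [mem_IcoBox] at hy hyT
  by_contra hle
  refine hyT fun i => ?_
  by_cases hij : i = j
  · subst hij; rw [Function.update_self]; exact ⟨not_lt.1 hle, (hy i).2⟩
  · rw [Function.update_of_ne hij]; exact hy i

/-- A point of the box outside the lower part has `t ≤ y_j`. [cite: Martinelli1999, Theorem 4.5, proof, p0189 L1] -/
theorem le_of_not_mem_bot {y : Site d} (hy : y ∈ (Fintype.piFinset fun i => Finset.Ico ((a) i) ((b) i))) (hyB : y ∉ (Fintype.piFinset fun i => Finset.Ico ((a) i) ((Function.update b j t) i))) : t ≤ y j := by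
  rw [mem_IcoBox] at hy hyB
  by_contra hlt
  refine hyB fun i => ?_
  by_cases hij : i = j
  · subst hij; rw [Function.update_self]; exact ⟨(hy i).1, not_le.1 hlt⟩
  · rw [Function.update_of_ne hij]; exact hy i

end Split

/-! ### The two-block density bound and the two-block gap -/

section TwoBlock

variable {r : ℕ} (U : FRPotential d ℤˣ r) (β : ℝ)

set_option maxHeartbeats 1600000 in
/-- **(3.33) for a split box from `SMT` on `ρ`-boxes** ([Mar99] Theorem 4.5, proof, p0189 L3–7, in the repaired
form of `GibbsRelativeDensitySMT`): `Q = Π[a_i,b_i)`, `Top = {y_j ≥ s}`, `Bot = {y_j < t}`, `a_j ≤ s < t ≤ b_j`,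
overlap width `t − s ≥ ρ + r`, all other sides `≥ ρ + 1`, `ρ ≥ r`; `SMT(Q', l, m)` for every box `Q'` with sides
in `[ρ+1−r, 2ρ+1]`, `l + 2r ≤ ρ`.  Then for every `τ` and every `𝓕_{∂_r^+Bot}`-local event `E`,
`|μ_Top^τ(E) − μ_Q^τ(E)| ≤ κ/(1−κ) μ_Q^τ(E)`, where `κ = (1+a)^{|∂_r^+Top ∩ Bot|} − 1` (assumed `< 1`) and
`a = R⁶ (2r+1)^{2d} |∂_r^+(Top∩Bot) ∩ Top| (2(ρ+r)+1)^d e^{−m(ρ−2r)}`.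
[cite: Martinelli1999, Theorem 4.5, proof, p0189 L3–7] -/
theorem boxSplit_density_bound {R : ℝ} (hR1 : 1 ≤ R)
    (hR : ∀ (Λ : Finset (Site d)) (y : Site d) (σ : Site d → ℤˣ),
      R⁻¹ ≤ flipWeight U β Λ y σ ∧ flipWeight U β Λ y σ ≤ R)
    {a b : Site d} {j : Fin d} {s t : ℤ} (hs : a j ≤ s) (hst : s < t) (ht : t ≤ b j)
    {ρ : ℕ} (hρr : r ≤ ρ) (hρst : (ρ : ℤ) + r ≤ t - s) (hwide : ∀ i, i ≠ j → (ρ : ℤ) + 1 ≤ b i - a i)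
    {l m : ℝ} (hm : 0 ≤ m) (hl : l ≤ (ρ : ℝ) - 2 * r)
    (hSMT : ∀ a' b' : Site d, (∀ i, (ρ : ℤ) + 1 - r ≤ b' i - a' i ∧ b' i - a' i ≤ 2 * ρ + 1) →
      SMT (U.spec β) (Fintype.piFinset fun i => Finset.Ico ((a') i) ((b') i)) l m)
    (hκ : (1 + R ^ 6 * (2 * r + 1 : ℝ) ^ d * (2 * r + 1 : ℝ) ^ d *
        ((rOuterBoundary r ((Fintype.piFinset fun i => Finset.Ico ((Function.update a j s) i) ((b) i)) ∩ (Fintype.piFinset fun i => Finset.Ico ((a) i) ((Function.update b j t) i)))).filter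
          (· ∈ (Fintype.piFinset fun i => Finset.Ico ((Function.update a j s) i) ((b) i)))).card *
        ((2 * (ρ + r) + 1) ^ d : ℕ) * Real.exp (-(m * ((ρ : ℝ) - 2 * r)))) ^
        ((rOuterBoundary r (Fintype.piFinset fun i => Finset.Ico ((Function.update a j s) i) ((b) i))).filter (· ∈ (Fintype.piFinset fun i => Finset.Ico ((a) i) ((Function.update b j t) i)))).card - 1 < 1)
    (τ : Site d → ℤˣ) {E : Set (Site d → ℤˣ)} (hE : MeasurableSet E)
    (hEB : DependsOn (· ∈ E) (↑(rOuterBoundary r (Fintype.piFinset fun i => Finset.Ico ((a) i) ((Function.update b j t) i))) : Set (Site d))) :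
    |(U.spec β (Fintype.piFinset fun i => Finset.Ico ((Function.update a j s) i) ((b) i)) τ).real E - (U.spec β (Fintype.piFinset fun i => Finset.Ico ((a) i) ((b) i)) τ).real E| ≤
      (((1 + R ^ 6 * (2 * r + 1 : ℝ) ^ d * (2 * r + 1 : ℝ) ^ d *
        ((rOuterBoundary r ((Fintype.piFinset fun i => Finset.Ico ((Function.update a j s) i) ((b) i)) ∩ (Fintype.piFinset fun i => Finset.Ico ((a) i) ((Function.update b j t) i)))).filter
          (· ∈ (Fintype.piFinset fun i => Finset.Ico ((Function.update a j s) i) ((b) i)))).card *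
        ((2 * (ρ + r) + 1) ^ d : ℕ) * Real.exp (-(m * ((ρ : ℝ) - 2 * r)))) ^
        ((rOuterBoundary r (Fintype.piFinset fun i => Finset.Ico ((Function.update a j s) i) ((b) i))).filter (· ∈ (Fintype.piFinset fun i => Finset.Ico ((a) i) ((Function.update b j t) i)))).card - 1) /
      (1 - ((1 + R ^ 6 * (2 * r + 1 : ℝ) ^ d * (2 * r + 1 : ℝ) ^ d *
        ((rOuterBoundary r ((Fintype.piFinset fun i => Finset.Ico ((Function.update a j s) i) ((b) i)) ∩ (Fintype.piFinset fun i => Finset.Ico ((a) i) ((Function.update b j t) i)))).filter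
          (· ∈ (Fintype.piFinset fun i => Finset.Ico ((Function.update a j s) i) ((b) i)))).card *
        ((2 * (ρ + r) + 1) ^ d : ℕ) * Real.exp (-(m * ((ρ : ℝ) - 2 * r)))) ^
        ((rOuterBoundary r (Fintype.piFinset fun i => Finset.Ico ((Function.update a j s) i) ((b) i))).filter (· ∈ (Fintype.piFinset fun i => Finset.Ico ((a) i) ((Function.update b j t) i)))).card - 1))) *
      (U.spec β (Fintype.piFinset fun i => Finset.Ico ((a) i) ((b) i)) τ).real E := by
  classical
  set Top := (Fintype.piFinset fun i => Finset.Ico ((Function.update a j s) i) ((b) i)) with hTop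
  set Bot := (Fintype.piFinset fun i => Finset.Ico ((a) i) ((Function.update b j t) i)) with hBot
  set Q := (Fintype.piFinset fun i => Finset.Ico ((a) i) ((b) i)) with hQ
  have hTQ : Top ⊆ Q := IcoBox_top_subset a b j s hs
  have hBQ : Bot ⊆ Q := IcoBox_bot_subset a b j t ht
  have hunion : Top ∪ Bot = Q := IcoBox_top_union_bot a b j s t hs hst.le ht
  have hinter : Top ∩ Bot = (Fintype.piFinset fun i => Finset.Ico ((Function.update a j s) i) ((Function.update b j t) i)) := IcoBox_top_inter_bot a b j s t hs ht
  have hρ0 : (0 : ℤ) ≤ ρ := by positivity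
  -- flip sites: `y ∈ ∂_r^+Top ∩ Bot` has `s − r ≤ y j < s`
  have hflip : ∀ y ∈ (rOuterBoundary r Top).filter (· ∈ Bot), y ∈ Q ∧ y j < s ∧ s - r ≤ y j := by
    intro y hy
    obtain ⟨hyBd, hyB⟩ := Finset.mem_filter.1 hy
    obtain ⟨hyT, z, hzT, hyz⟩ := mem_rOuterBoundary.1 hyBd
    have hyQ := hBQ hyB
    refine ⟨hyQ, lt_of_not_mem_top a b j s hyQ hyT, ?_⟩
    have hzj : s ≤ z j := by
      have := (mem_IcoBox.1 hzT j).1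
      rwa [Function.update_self] at this
    have h1 := abs_sub_le_supDist y z j
    have h2 : (supDist y z : ℤ) ≤ r := by exact_mod_cast hyz
    have h3 := (abs_le.1 (h1.trans h2)).1
    linarith
  -- separation of the flip sites from `Top ∖ Bot`
  have hsep : ∀ y ∈ (rOuterBoundary r Top).filter (· ∈ Bot), ∀ z ∈ Top \ Bot, r < supDist z y := by
    intro y hy z hz
    obtain ⟨-, hyj, -⟩ := hflip y hy
    obtain ⟨hzT, hzB⟩ := Finset.mem_sdiff.1 hz
    have hzj : t ≤ z j := le_of_not_mem_bot a b j t (hTQ hzT) hzB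
    have h1 : ((r + 1 : ℕ) : ℤ) ≤ |z j - y j| := by
      rw [abs_of_nonneg (by linarith)]
      push_cast
      linarith
    have := le_supDist_of_le_abs_sub h1
    omega
  -- the ρ-boxes around the flip sites
  have hbox : ∀ y ∈ (rOuterBoundary r Top).filter (· ∈ Bot), ∃ A' : Finset (Site d), A' ⊆ Top ∩ Bot ∧
      (∀ w ∈ rNeighbourhood r y, w ∈ Top ∩ Bot → w ∈ A') ∧
      (∀ z ∈ (rOuterBoundary r (Top ∩ Bot)).filter (· ∈ Top), ∀ w ∈ rNeighbourhood r z, w ∉ A') ∧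
      (∀ w ∈ (rOuterBoundary r A').filter (· ∈ Top ∩ Bot), ρ ≤ supDist w y) ∧
      ((rOuterBoundary r A').filter (· ∈ Top ∩ Bot)).card ≤ (2 * (ρ + r) + 1) ^ d ∧ SMT (U.spec β) A' l m := by
    intro y hy
    obtain ⟨hyQ, hyj, hyj'⟩ := hflip y hy
    have hyQ' := mem_IcoBox.1 hyQ
    set a' : Site d := fun i => max (Function.update a j s i) (y i - ρ) with ha'
    set b' : Site d := fun i => min (Function.update b j t i) (y i + ρ + 1) with hb'
    refine ⟨(Fintype.piFinset fun i => Finset.Ico ((a') i) ((b') i)), ?_, ?_, ?_, ?_, ?_, ?_⟩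
    · -- (1) inside the strip
      rw [hinter]
      intro w hw
      rw [mem_IcoBox] at hw ⊢
      intro i
      obtain ⟨h1, h2⟩ := hw i
      exact ⟨le_of_max_le_left h1, lt_of_lt_of_le h2 (min_le_left _ _)⟩
    · -- (2) contains `N_r(y) ∩ strip`
      intro w hw hwS
      rw [hinter, mem_IcoBox] at hwS
      rw [mem_rNeighbourhood] at hw
      rw [mem_IcoBox]
      intro i
      obtain ⟨h1, h2⟩ := hwS i
      have h3 := abs_sub_le_supDist w y i
      have h4 : (supDist w y : ℤ) ≤ r := by exact_mod_cast hw
      obtain ⟨h5, h6⟩ := abs_le.1 (h3.trans h4)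
      have hρr' : (r : ℤ) ≤ ρ := by exact_mod_cast hρr
      refine ⟨max_le h1 (by linarith), lt_min h2 (by linarith)⟩
    · -- (3) avoids `N_r(z)` for `z ∈ ∂_r^+(strip) ∩ Top`
      intro z hz w hw hwA
      obtain ⟨hzBd, hzT⟩ := Finset.mem_filter.1 hz
      have hzS : z ∉ Top ∩ Bot := (mem_rOuterBoundary.1 hzBd).1
      have hzB : z ∉ Bot := fun h => hzS (Finset.mem_inter.2 ⟨hzT, h⟩)
      have hzj : t ≤ z j := le_of_not_mem_bot a b j t (hTQ hzT) hzB
      rw [mem_rNeighbourhood] at hw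
      have h3 := abs_sub_le_supDist w z j
      have h4 : (supDist w z : ℤ) ≤ r := by exact_mod_cast hw
      obtain ⟨h5, -⟩ := abs_le.1 (h3.trans h4)
      have hwj : w j < b' j := (mem_IcoBox.1 hwA j).2
      have hb'j : b' j ≤ y j + ρ + 1 := min_le_right _ _
      linarith
    · -- (4) boundary of the ρ-box inside the strip is at distance `≥ ρ` from `y`
      intro w hw
      obtain ⟨hwBd, hwS⟩ := Finset.mem_filter.1 hw
      have hwA : w ∉ (Fintype.piFinset fun i => Finset.Ico ((a') i) ((b') i)) := (mem_rOuterBoundary.1 hwBd).1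
      rw [hinter, mem_IcoBox] at hwS
      rw [mem_IcoBox, not_forall] at hwA
      obtain ⟨i, hi⟩ := hwA
      obtain ⟨hs1, hs2⟩ := hwS i
      have key : (ρ : ℤ) ≤ |w i - y i| := by
        rw [not_and_or, not_le, not_lt] at hi
        rcases hi with hlo | hhi
        · have : w i < y i - ρ := by
            rcases lt_max_iff.1 hlo with h | h
            · exact absurd hs1 (not_le.2 h)
            · exact h
          rw [abs_of_neg (by linarith)]; linarith
        · have : y i + ρ + 1 ≤ w i := by
            rcases min_le_iff.1 hhi with h | h
            · exact absurd hs2 (not_lt.2 h)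
            · exact h
          rw [abs_of_nonneg (by linarith)]; linarith
      exact le_supDist_of_le_abs_sub key
    · -- (5) its cardinality
      refine (Finset.card_le_card (fun w hw => ?_)).trans (card_rNeighbourhood (ρ + r) y).le
      obtain ⟨hwBd, -⟩ := Finset.mem_filter.1 hw
      obtain ⟨-, v, hvA, hwv⟩ := mem_rOuterBoundary.1 hwBd
      rw [mem_rNeighbourhood]
      have hvy : supDist v y ≤ ρ := by
        refine supDist_le_of_abs_sub_le fun i => ?_
        obtain ⟨h1, h2⟩ := mem_IcoBox.1 hvA i
        have h3 : y i - ρ ≤ v i := le_of_max_le_right h1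
        have h4 : v i < y i + ρ + 1 := lt_of_lt_of_le h2 (min_le_right _ _)
        rw [abs_le]; constructor <;> linarith
      have := supDist_triangle'' w v y
      omega
    · -- (6) it is a box with sides in `[ρ+1−r, 2ρ+1]`
      refine hSMT a' b' fun i => ?_
      obtain ⟨hy1, hy2⟩ := hyQ' i
      by_cases hij : i = j
      · subst hij
        have ha'j : a' i = s := by
          show max (Function.update a i s i) (y i - ρ) = s
          rw [Function.update_self]; exact max_eq_left (by linarith)
        have hb'j : b' i = y i + ρ + 1 := by
          show min (Function.update b i t i) (y i + ρ + 1) = y i + ρ + 1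
          rw [Function.update_self]; exact min_eq_right (by linarith)
        rw [ha'j, hb'j]
        constructor <;> linarith
      · have hwi := hwide i hij
        have ha'i : a' i = max (a i) (y i - ρ) := by
          show max (Function.update a j s i) (y i - ρ) = _
          rw [Function.update_of_ne hij]
        have hb'i : b' i = min (b i) (y i + ρ + 1) := by
          show min (Function.update b j t i) (y i + ρ + 1) = _
          rw [Function.update_of_ne hij]
        rw [ha'i, hb'i]
        have hρr' : (r : ℤ) ≤ ρ := by exact_mod_cast hρr
        rcases le_total (a i) (y i - ρ) with h1 | h1 <;> rcases le_total (b i) (y i + ρ + 1) with h2 | h2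
        · rw [max_eq_right h1, min_eq_left h2]; constructor <;> linarith
        · rw [max_eq_right h1, min_eq_right h2]; constructor <;> linarith
        · rw [max_eq_left h1, min_eq_left h2]; constructor <;> linarith
        · rw [max_eq_left h1, min_eq_right h2]; constructor <;> linarith
  have h := abs_spec_real_sub_union_le_of_local_SMT U β hR1 hR (A := Top) (B := Bot) hsep
    (ρ := ρ) (P := (2 * (ρ + r) + 1) ^ d) hm hl hbox hκ τ hE hEB
  rwa [hunion] at h

/-- **Two-block gap for the split box** ([Mar99] Theorem 4.5, proof: (3.33) + Proposition 3.5): under the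
hypotheses of `boxSplit_density_bound` with `κ < ½` (so that `ε = κ/(1−κ) < 1`), the block dynamics `{Top, Bot}`
in `Q` satisfies `gap ≥ 1 − √ε`, i.e. `BlockPoincareIneq μ ![Top, Bot] Q τ (1 − √ε)` for every `τ`.
[cite: Martinelli1999, Theorem 4.5, proof, p0189 L7–14] -/
theorem boxSplit_blockPoincare {R : ℝ} (hR1 : 1 ≤ R)
    (hR : ∀ (Λ : Finset (Site d)) (y : Site d) (σ : Site d → ℤˣ),
      R⁻¹ ≤ flipWeight U β Λ y σ ∧ flipWeight U β Λ y σ ≤ R)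
    {a b : Site d} {j : Fin d} {s t : ℤ} (hs : a j ≤ s) (hst : s < t) (ht : t ≤ b j)
    {ρ : ℕ} (hρr : r ≤ ρ) (hρst : (ρ : ℤ) + r ≤ t - s) (hwide : ∀ i, i ≠ j → (ρ : ℤ) + 1 ≤ b i - a i)
    {l m : ℝ} (hm : 0 ≤ m) (hl : l ≤ (ρ : ℝ) - 2 * r)
    (hSMT : ∀ a' b' : Site d, (∀ i, (ρ : ℤ) + 1 - r ≤ b' i - a' i ∧ b' i - a' i ≤ 2 * ρ + 1) →
      SMT (U.spec β) (Fintype.piFinset fun i => Finset.Ico ((a') i) ((b') i)) l m)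
    {κ : ℝ} (hκdef : κ = (1 + R ^ 6 * (2 * r + 1 : ℝ) ^ d * (2 * r + 1 : ℝ) ^ d *
        ((rOuterBoundary r ((Fintype.piFinset fun i => Finset.Ico ((Function.update a j s) i) ((b) i)) ∩ (Fintype.piFinset fun i => Finset.Ico ((a) i) ((Function.update b j t) i)))).filter
          (· ∈ (Fintype.piFinset fun i => Finset.Ico ((Function.update a j s) i) ((b) i)))).card *
        ((2 * (ρ + r) + 1) ^ d : ℕ) * Real.exp (-(m * ((ρ : ℝ) - 2 * r)))) ^
        ((rOuterBoundary r (Fintype.piFinset fun i => Finset.Ico ((Function.update a j s) i) ((b) i))).filter (· ∈ (Fintype.piFinset fun i => Finset.Ico ((a) i) ((Function.update b j t) i)))).card - 1)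
    (hκ : κ < 1 / 2) (τ : Site d → ℤˣ) :
    BlockPoincareIneq (U.spec β) ![(Fintype.piFinset fun i => Finset.Ico ((Function.update a j s) i) ((b) i)), (Fintype.piFinset fun i => Finset.Ico ((a) i) ((Function.update b j t) i))] (Fintype.piFinset fun i => Finset.Ico ((a) i) ((b) i)) τ
      (1 - Real.sqrt (κ / (1 - κ))) := by
  classical
  have hκ0 : 0 ≤ κ := by
    rw [hκdef, sub_nonneg]
    exact one_le_pow₀ (le_add_of_nonneg_right (by positivity))
  have hε0 : 0 ≤ κ / (1 - κ) := div_nonneg hκ0 (by linarith)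
  have hε1 : κ / (1 - κ) < 1 := by rw [div_lt_one (by linarith)]; linarith
  have hκ1 : κ < 1 := by linarith
  have h35 := Martinelli1999_prop3_5_holds U β (Fintype.piFinset fun i => Finset.Ico ((Function.update a j s) i) ((b) i)) (Fintype.piFinset fun i => Finset.Ico ((a) i) ((Function.update b j t) i))
    (κ / (1 - κ)) hε0 hε1 (fun τ' E hE hEB => by
      have h := boxSplit_density_bound U β hR1 hR hs hst ht hρr hρst hwide hm hl hSMT (by rw [← hκdef]; exact hκ1)
        τ' hE hEB
      rw [← hκdef] at h
      rwa [IcoBox_top_union_bot a b j s t hs hst.le ht]) τ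
  rwa [IcoBox_top_union_bot a b j s t hs hst.le ht] at h35

/-- **(3.33) for a split box, for events reading no spin of `Bot`** (support `T` with `T ∩ Bot = ∅`; the
form needed for [Mar99] Theorem 4.6 (4.21), feeding `integral_sq_mul_log_le_of_LSI_of_dominated`) — same proof
as `boxSplit_density_bound` with `abs_spec_real_sub_union_le_of_local_SMT'`.
Original: **(3.33) for a split box from `SMT` on `ρ`-boxes** ([Mar99] Theorem 4.5, proof, p0189 L3–7, in the repaired
form of `GibbsRelativeDensitySMT`): `Q = Π[a_i,b_i)`, `Top = {y_j ≥ s}`, `Bot = {y_j < t}`, `a_j ≤ s < t ≤ b_j`,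
overlap width `t − s ≥ ρ + r`, all other sides `≥ ρ + 1`, `ρ ≥ r`; `SMT(Q', l, m)` for every box `Q'` with sides
in `[ρ+1−r, 2ρ+1]`, `l + 2r ≤ ρ`.  Then for every `τ` and every `𝓕_{∂_r^+Bot}`-local event `E`,
`|μ_Top^τ(E) − μ_Q^τ(E)| ≤ κ/(1−κ) μ_Q^τ(E)`, where `κ = (1+a)^{|∂_r^+Top ∩ Bot|} − 1` (assumed `< 1`) and
`a = R⁶ (2r+1)^{2d} |∂_r^+(Top∩Bot) ∩ Top| (2(ρ+r)+1)^d e^{−m(ρ−2r)}`.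
[cite: Martinelli1999, Theorem 4.5, proof, p0189 L3–7] -/
theorem boxSplit_density_bound' {R : ℝ} (hR1 : 1 ≤ R)
    (hR : ∀ (Λ : Finset (Site d)) (y : Site d) (σ : Site d → ℤˣ),
      R⁻¹ ≤ flipWeight U β Λ y σ ∧ flipWeight U β Λ y σ ≤ R)
    {a b : Site d} {j : Fin d} {s t : ℤ} (hs : a j ≤ s) (hst : s < t) (ht : t ≤ b j)
    {ρ : ℕ} (hρr : r ≤ ρ) (hρst : (ρ : ℤ) + r ≤ t - s) (hwide : ∀ i, i ≠ j → (ρ : ℤ) + 1 ≤ b i - a i)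
    {l m : ℝ} (hm : 0 ≤ m) (hl : l ≤ (ρ : ℝ) - 2 * r)
    (hSMT : ∀ a' b' : Site d, (∀ i, (ρ : ℤ) + 1 - r ≤ b' i - a' i ∧ b' i - a' i ≤ 2 * ρ + 1) →
      SMT (U.spec β) (Fintype.piFinset fun i => Finset.Ico ((a') i) ((b') i)) l m)
    (hκ : (1 + R ^ 6 * (2 * r + 1 : ℝ) ^ d * (2 * r + 1 : ℝ) ^ d *
        ((rOuterBoundary r ((Fintype.piFinset fun i => Finset.Ico ((Function.update a j s) i) ((b) i)) ∩ (Fintype.piFinset fun i => Finset.Ico ((a) i) ((Function.update b j t) i)))).filter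
          (· ∈ (Fintype.piFinset fun i => Finset.Ico ((Function.update a j s) i) ((b) i)))).card *
        ((2 * (ρ + r) + 1) ^ d : ℕ) * Real.exp (-(m * ((ρ : ℝ) - 2 * r)))) ^
        ((rOuterBoundary r (Fintype.piFinset fun i => Finset.Ico ((Function.update a j s) i) ((b) i))).filter (· ∈ (Fintype.piFinset fun i => Finset.Ico ((a) i) ((Function.update b j t) i)))).card - 1 < 1)
    (τ : Site d → ℤˣ) {E : Set (Site d → ℤˣ)} (hE : MeasurableSet E) {T : Set (Site d)}
    (hET : DependsOn (· ∈ E) T)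
    (hTB : ∀ z ∈ T, z ∉ (Fintype.piFinset fun i => Finset.Ico ((a) i) ((Function.update b j t) i))) :
    |(U.spec β (Fintype.piFinset fun i => Finset.Ico ((Function.update a j s) i) ((b) i)) τ).real E - (U.spec β (Fintype.piFinset fun i => Finset.Ico ((a) i) ((b) i)) τ).real E| ≤
      (((1 + R ^ 6 * (2 * r + 1 : ℝ) ^ d * (2 * r + 1 : ℝ) ^ d *
        ((rOuterBoundary r ((Fintype.piFinset fun i => Finset.Ico ((Function.update a j s) i) ((b) i)) ∩ (Fintype.piFinset fun i => Finset.Ico ((a) i) ((Function.update b j t) i)))).filter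
          (· ∈ (Fintype.piFinset fun i => Finset.Ico ((Function.update a j s) i) ((b) i)))).card *
        ((2 * (ρ + r) + 1) ^ d : ℕ) * Real.exp (-(m * ((ρ : ℝ) - 2 * r)))) ^
        ((rOuterBoundary r (Fintype.piFinset fun i => Finset.Ico ((Function.update a j s) i) ((b) i))).filter (· ∈ (Fintype.piFinset fun i => Finset.Ico ((a) i) ((Function.update b j t) i)))).card - 1) /
      (1 - ((1 + R ^ 6 * (2 * r + 1 : ℝ) ^ d * (2 * r + 1 : ℝ) ^ d *
        ((rOuterBoundary r ((Fintype.piFinset fun i => Finset.Ico ((Function.update a j s) i) ((b) i)) ∩ (Fintype.piFinset fun i => Finset.Ico ((a) i) ((Function.update b j t) i)))).filter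
          (· ∈ (Fintype.piFinset fun i => Finset.Ico ((Function.update a j s) i) ((b) i)))).card *
        ((2 * (ρ + r) + 1) ^ d : ℕ) * Real.exp (-(m * ((ρ : ℝ) - 2 * r)))) ^
        ((rOuterBoundary r (Fintype.piFinset fun i => Finset.Ico ((Function.update a j s) i) ((b) i))).filter (· ∈ (Fintype.piFinset fun i => Finset.Ico ((a) i) ((Function.update b j t) i)))).card - 1))) *
      (U.spec β (Fintype.piFinset fun i => Finset.Ico ((a) i) ((b) i)) τ).real E := by
  classical
  set Top := (Fintype.piFinset fun i => Finset.Ico ((Function.update a j s) i) ((b) i)) with hTop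
  set Bot := (Fintype.piFinset fun i => Finset.Ico ((a) i) ((Function.update b j t) i)) with hBot
  set Q := (Fintype.piFinset fun i => Finset.Ico ((a) i) ((b) i)) with hQ
  have hTQ : Top ⊆ Q := IcoBox_top_subset a b j s hs
  have hBQ : Bot ⊆ Q := IcoBox_bot_subset a b j t ht
  have hunion : Top ∪ Bot = Q := IcoBox_top_union_bot a b j s t hs hst.le ht
  have hinter : Top ∩ Bot = (Fintype.piFinset fun i => Finset.Ico ((Function.update a j s) i) ((Function.update b j t) i)) := IcoBox_top_inter_bot a b j s t hs ht
  have hρ0 : (0 : ℤ) ≤ ρ := by positivity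
  -- flip sites: `y ∈ ∂_r^+Top ∩ Bot` has `s − r ≤ y j < s`
  have hflip : ∀ y ∈ (rOuterBoundary r Top).filter (· ∈ Bot), y ∈ Q ∧ y j < s ∧ s - r ≤ y j := by
    intro y hy
    obtain ⟨hyBd, hyB⟩ := Finset.mem_filter.1 hy
    obtain ⟨hyT, z, hzT, hyz⟩ := mem_rOuterBoundary.1 hyBd
    have hyQ := hBQ hyB
    refine ⟨hyQ, lt_of_not_mem_top a b j s hyQ hyT, ?_⟩
    have hzj : s ≤ z j := by
      have := (mem_IcoBox.1 hzT j).1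
      rwa [Function.update_self] at this
    have h1 := abs_sub_le_supDist y z j
    have h2 : (supDist y z : ℤ) ≤ r := by exact_mod_cast hyz
    have h3 := (abs_le.1 (h1.trans h2)).1
    linarith
  -- separation of the flip sites from `Top ∖ Bot`
  have hsep : ∀ y ∈ (rOuterBoundary r Top).filter (· ∈ Bot), ∀ z ∈ Top \ Bot, r < supDist z y := by
    intro y hy z hz
    obtain ⟨-, hyj, -⟩ := hflip y hy
    obtain ⟨hzT, hzB⟩ := Finset.mem_sdiff.1 hz
    have hzj : t ≤ z j := le_of_not_mem_bot a b j t (hTQ hzT) hzB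
    have h1 : ((r + 1 : ℕ) : ℤ) ≤ |z j - y j| := by
      rw [abs_of_nonneg (by linarith)]
      push_cast
      linarith
    have := le_supDist_of_le_abs_sub h1
    omega
  -- the ρ-boxes around the flip sites
  have hbox : ∀ y ∈ (rOuterBoundary r Top).filter (· ∈ Bot), ∃ A' : Finset (Site d), A' ⊆ Top ∩ Bot ∧
      (∀ w ∈ rNeighbourhood r y, w ∈ Top ∩ Bot → w ∈ A') ∧
      (∀ z ∈ (rOuterBoundary r (Top ∩ Bot)).filter (· ∈ Top), ∀ w ∈ rNeighbourhood r z, w ∉ A') ∧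
      (∀ w ∈ (rOuterBoundary r A').filter (· ∈ Top ∩ Bot), ρ ≤ supDist w y) ∧
      ((rOuterBoundary r A').filter (· ∈ Top ∩ Bot)).card ≤ (2 * (ρ + r) + 1) ^ d ∧ SMT (U.spec β) A' l m := by
    intro y hy
    obtain ⟨hyQ, hyj, hyj'⟩ := hflip y hy
    have hyQ' := mem_IcoBox.1 hyQ
    set a' : Site d := fun i => max (Function.update a j s i) (y i - ρ) with ha'
    set b' : Site d := fun i => min (Function.update b j t i) (y i + ρ + 1) with hb'
    refine ⟨(Fintype.piFinset fun i => Finset.Ico ((a') i) ((b') i)), ?_, ?_, ?_, ?_, ?_, ?_⟩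
    · -- (1) inside the strip
      rw [hinter]
      intro w hw
      rw [mem_IcoBox] at hw ⊢
      intro i
      obtain ⟨h1, h2⟩ := hw i
      exact ⟨le_of_max_le_left h1, lt_of_lt_of_le h2 (min_le_left _ _)⟩
    · -- (2) contains `N_r(y) ∩ strip`
      intro w hw hwS
      rw [hinter, mem_IcoBox] at hwS
      rw [mem_rNeighbourhood] at hw
      rw [mem_IcoBox]
      intro i
      obtain ⟨h1, h2⟩ := hwS i
      have h3 := abs_sub_le_supDist w y i
      have h4 : (supDist w y : ℤ) ≤ r := by exact_mod_cast hw
      obtain ⟨h5, h6⟩ := abs_le.1 (h3.trans h4)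
      have hρr' : (r : ℤ) ≤ ρ := by exact_mod_cast hρr
      refine ⟨max_le h1 (by linarith), lt_min h2 (by linarith)⟩
    · -- (3) avoids `N_r(z)` for `z ∈ ∂_r^+(strip) ∩ Top`
      intro z hz w hw hwA
      obtain ⟨hzBd, hzT⟩ := Finset.mem_filter.1 hz
      have hzS : z ∉ Top ∩ Bot := (mem_rOuterBoundary.1 hzBd).1
      have hzB : z ∉ Bot := fun h => hzS (Finset.mem_inter.2 ⟨hzT, h⟩)
      have hzj : t ≤ z j := le_of_not_mem_bot a b j t (hTQ hzT) hzB
      rw [mem_rNeighbourhood] at hw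
      have h3 := abs_sub_le_supDist w z j
      have h4 : (supDist w z : ℤ) ≤ r := by exact_mod_cast hw
      obtain ⟨h5, -⟩ := abs_le.1 (h3.trans h4)
      have hwj : w j < b' j := (mem_IcoBox.1 hwA j).2
      have hb'j : b' j ≤ y j + ρ + 1 := min_le_right _ _
      linarith
    · -- (4) boundary of the ρ-box inside the strip is at distance `≥ ρ` from `y`
      intro w hw
      obtain ⟨hwBd, hwS⟩ := Finset.mem_filter.1 hw
      have hwA : w ∉ (Fintype.piFinset fun i => Finset.Ico ((a') i) ((b') i)) := (mem_rOuterBoundary.1 hwBd).1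
      rw [hinter, mem_IcoBox] at hwS
      rw [mem_IcoBox, not_forall] at hwA
      obtain ⟨i, hi⟩ := hwA
      obtain ⟨hs1, hs2⟩ := hwS i
      have key : (ρ : ℤ) ≤ |w i - y i| := by
        rw [not_and_or, not_le, not_lt] at hi
        rcases hi with hlo | hhi
        · have : w i < y i - ρ := by
            rcases lt_max_iff.1 hlo with h | h
            · exact absurd hs1 (not_le.2 h)
            · exact h
          rw [abs_of_neg (by linarith)]; linarith
        · have : y i + ρ + 1 ≤ w i := by
            rcases min_le_iff.1 hhi with h | h
            · exact absurd hs2 (not_lt.2 h)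
            · exact h
          rw [abs_of_nonneg (by linarith)]; linarith
      exact le_supDist_of_le_abs_sub key
    · -- (5) its cardinality
      refine (Finset.card_le_card (fun w hw => ?_)).trans (card_rNeighbourhood (ρ + r) y).le
      obtain ⟨hwBd, -⟩ := Finset.mem_filter.1 hw
      obtain ⟨-, v, hvA, hwv⟩ := mem_rOuterBoundary.1 hwBd
      rw [mem_rNeighbourhood]
      have hvy : supDist v y ≤ ρ := by
        refine supDist_le_of_abs_sub_le fun i => ?_
        obtain ⟨h1, h2⟩ := mem_IcoBox.1 hvA i
        have h3 : y i - ρ ≤ v i := le_of_max_le_right h1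
        have h4 : v i < y i + ρ + 1 := lt_of_lt_of_le h2 (min_le_right _ _)
        rw [abs_le]; constructor <;> linarith
      have := supDist_triangle'' w v y
      omega
    · -- (6) it is a box with sides in `[ρ+1−r, 2ρ+1]`
      refine hSMT a' b' fun i => ?_
      obtain ⟨hy1, hy2⟩ := hyQ' i
      by_cases hij : i = j
      · subst hij
        have ha'j : a' i = s := by
          show max (Function.update a i s i) (y i - ρ) = s
          rw [Function.update_self]; exact max_eq_left (by linarith)
        have hb'j : b' i = y i + ρ + 1 := by
          show min (Function.update b i t i) (y i + ρ + 1) = y i + ρ + 1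
          rw [Function.update_self]; exact min_eq_right (by linarith)
        rw [ha'j, hb'j]
        constructor <;> linarith
      · have hwi := hwide i hij
        have ha'i : a' i = max (a i) (y i - ρ) := by
          show max (Function.update a j s i) (y i - ρ) = _
          rw [Function.update_of_ne hij]
        have hb'i : b' i = min (b i) (y i + ρ + 1) := by
          show min (Function.update b j t i) (y i + ρ + 1) = _
          rw [Function.update_of_ne hij]
        rw [ha'i, hb'i]
        have hρr' : (r : ℤ) ≤ ρ := by exact_mod_cast hρr
        rcases le_total (a i) (y i - ρ) with h1 | h1 <;> rcases le_total (b i) (y i + ρ + 1) with h2 | h2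
        · rw [max_eq_right h1, min_eq_left h2]; constructor <;> linarith
        · rw [max_eq_right h1, min_eq_right h2]; constructor <;> linarith
        · rw [max_eq_left h1, min_eq_left h2]; constructor <;> linarith
        · rw [max_eq_left h1, min_eq_right h2]; constructor <;> linarith
  have h := abs_spec_real_sub_union_le_of_local_SMT' U β hR1 hR (A := Top) (B := Bot) hsep
    (ρ := ρ) (P := (2 * (ρ + r) + 1) ^ d) hm hl hbox hκ τ hE hET hTB
  rwa [hunion] at h


end TwoBlock

end Glauber

end Literature.Probability.LatticeModels

end
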